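import Summits.Ventures.GridStability.Bench.KUNDUR2ACSGDeg4AOwnVDeg4Nu4ibk3m1PpTwinM3
import Summits.Ventures.GridStability.Bench.KUNDUR2ACSGDeg4AOwnVDeg4Nu4ibk3m1PpTwinC2
-- PORT certsdp.sos.packed.lean_twin_files (certnum-sdp-3 g5, out50 fileset sha16 bdf1046dae708ece, file bytes otherwise verbatim; staged/filed by gridfusion-sos-7 g0 per lead RULING 5q) / source cert/A/KUNDUR2A-CSG-deg4-A-ownV-deg4-nu4ibk3m1-pp.json sha256: 36c09ec489f469d09080d3070dd11696da37ce8d26561deee755fc53d4368fd8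
-- EMITTED by certsdp.sos.packed.lean_twin_files (rounded-twin PSD lane; twin sha16 fc027825db00f07b). #50 «G2.a-K2A-alg-deg4» 189-block PSD side — source block: pub/gridfusion/cert/A/KUNDUR2A-CSG-deg4-A-ownV-deg4-nu4ibk3m1-pp.json sha16 36c09ec489f469d0, identity Vdot_neg, free Gram block s = 189; client decls per gridfusion-sos-5 2026-08-27T10:00:08Z (namespace …Bench.KUNDUR2ACSG, `_free_Q`/`_freeL` visible from …PpData19 in the D8 layout of record; the module name may shift when the ℤ-lane shards are dropped — decl names fixed). certnum-sdp-3 g5, certsdp.sos packed.twin 0.1.3 + lean_twin_files 0.1.5-dev.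

/-!
# Rounded-twin PSD lane — the twin's packed rows DD certificate (KERNEL)

The rounded twin `M` (shipped as packed row numerals) is certified positive semidefinite by the packed rows lane (PackedGramCertificateRows.lean).
Twin parameters: K = 27 (S = 2^K), shift s = 348, factor scale b = 14 (M = 4^b·(round(S·Q) − s·1), entries ≤ 60 bits; packed DD certificate, unit weights, 30-bit factor digits; closeness constants S′ = 36028797018963968, s′ = 93415538688, e′ = 268435456, margin 189·e′ ≤ s′). Float λ_min(Q) ≈ 7.79e-06 was a SEED only; every inequality is decided by the kernel. WHAT THIS FILE DOES NOT CERTIFY: anything about the identity/model side; a file of DATA certifies nothing by itself. [cite: Rump1999VerifiedLargeSystems, §4 Alg. 4.1 step 7; BlekhermanParriloThomas2012, App. A.1.2]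
-/

namespace Summit.Ventures.GridStability.Bench.KUNDUR2ACSG

open Literature.Computation.Certificates

set_option maxHeartbeats 0 in
/-- KERNEL: the packed rows DD certificate of the twin passes (`PSD.Packed.checkRows` on the shipped row numerals `deg4_A_ownV_deg4_nu4ibk3m1_pp_Vdot_neg_free_twinA`, unit weights, factor `deg4_A_ownV_deg4_nu4ibk3m1_pp_Vdot_neg_free_twinC`; one `decide +kernel`). Its meaning — `PSD.IsGramCertZ (PSD.Packed.intMatrixRows 189 62 deg4_A_ownV_deg4_nu4ibk3m1_pp_Vdot_neg_free_twinA) …` — is `PSD.Packed.isGramCertZ_of_checkRows` (PackedGramCertificateRows.lean); the conclusion file applies it. [cite: BlekhermanParriloThomas2012, App. A.1.2] -/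
theorem deg4_A_ownV_deg4_nu4ibk3m1_pp_Vdot_neg_free_twin_check : PSD.Packed.checkRows 189 62 1 31 71 951156615 deg4_A_ownV_deg4_nu4ibk3m1_pp_Vdot_neg_free_twinA (List.replicate 189 1) deg4_A_ownV_deg4_nu4ibk3m1_pp_Vdot_neg_free_twinC = true := by
  decide +kernel

end Summit.Ventures.GridStability.Bench.KUNDUR2ACSG
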